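import Summits.CriticalPhenomena.Ising3DConformalLimit.Theorems.FKParityRobustnessParityBoundCurrents
import Literature.Probability.LatticeModels.IsingTransport
import Literature.Probability.LatticeModels.CriticalCorrWellDefined
import Literature.Probability.LatticeModels.ScalingLimit
import Summits.CriticalPhenomena.Ising3DConformalLimit.Theses.FKParityRobustness
import HarnessLib

/-!
# Crux `JoinForcesU4` (stmt-CriticalPhenomena-14627) — ideator 3, round 1: first lemmas AND a complete candidate proof

Idea card `iterated-oddpart-pushforward`.  This file ends with `theorem joinForcesU4 : JoinForcesU4`
(the route decl, kernel-closed, standard axioms) and proves on the way the route's support item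
`StrandsJoinBound` (as the verbatim primed copy `StrandsJoinBound'`, stmt-CriticalPhenomena-14647) and the
logic of `FarMergingGivesU4` (stmt-CriticalPhenomena-4471) in `hasNontrivialU4_of_tetraLatticeBound`.

The finite-graph core of the bridge
`IndependentStrandsJoin → NonGaussianLimit` is the LOOP-DRESSED AIZENMAN INEQUALITY

  `Z[D]Z[∅] + 2·cosh(β)^{2|E|}·J_t ≤ Z[01]Z[23] + Z[02]Z[13] + Z[03]Z[12]`     (ℝ≥0∞ current sums),

`J_t = Σ_{F₁ ∈ 𝒯(01)} Σ_{F₂ ∈ 𝒯(23)} t^{|F₁|+|F₂|} 1[a₀ ↔ a₂ in F₁ ∪ F₂]`, `t = tanh β`, obtained from two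
LANDED facts — the additive random-current identity for `U₄`
(`Current.ursellFour_currentSum_identity`) and the single-current odd-part pushforward
(`tsum_sources_eweight_mul_apply_oddPart`) — by iterating the pushforward over the product of the two
sourced currents (Tonelli, `ENNReal.tsum_prod'`) and the inclusion `odd(nᵢ) ⊆ trace(n₁+n₂)`.
-/

noncomputable section

open Finset MeasureTheory Filter Topology
open scoped symmDiff ENNReal
open Literature.Probability.LatticeModels
open Summit.CriticalPhenomena.Ising3DConformalLimit.Theorems

namespace Summit.CriticalPhenomena.Ising3DConformalLimit.Cruxes.JoinForcesU4.Sketch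

open scoped Classical

section FiniteGraph

variable {V : Type*} [Fintype V] [DecidableEq V] {G : SimpleGraph V} [DecidableRel G.Adj]

/-- The odd part `odd(n) = {e ∈ E(G) : n_e odd}` of a current (the inlined term of the landed file
`FKParityRobustnessParityBoundCurrents`, abbreviated here for readability only). -/
abbrev oddPart (n : Current G) : Finset (Sym2 V) :=
  (univ.filter fun e : G.edgeFinset => Odd (n e)).map (Function.Embedding.subtype _)

/-- **FIRST LEMMA (a) — the two-current odd-part pushforward** (exact): under the product weight
`1{∂n₁ = A} 1{∂n₂ = B} w_β(n₁) w_β(n₂)` the pair of odd parts `(odd n₁, odd n₂)` is distributed as two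
INDEPENDENT sourced loop-O(1) configurations, `ℓ^A_t ⊗ ℓ^B_t` up to the factor `cosh(β)^{2|E|}`:
`Σ_{∂n₁=A,∂n₂=B} w w g(odd n₁, odd n₂) = Σ_{∂F₁=A} Σ_{∂F₂=B} (sinh^{|F₁|}cosh^{|E|-|F₁|})(sinh^{|F₂|}cosh^{|E|-|F₂|}) g(F₁,F₂)`.
Proof: Tonelli (`ENNReal.tsum_prod'`) and the landed single-current pushforward applied to the inner
and then to the outer sum. -/
theorem tsum_epairWeight_mul_apply_oddParts {β : ℝ} (hβ : 0 ≤ β) (A B : Finset V)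
    (g : Finset (Sym2 V) → Finset (Sym2 V) → ℝ≥0∞) :
    ∑' p : Current G × Current G,
        epairWeight (fun _ : G.edgeFinset => β) A B p * g (oddPart p.1) (oddPart p.2) =
      ∑ F₁ ∈ G.edgeFinset.powerset, if (∀ v, Odd #(F₁.filter (v ∈ ·)) ↔ v ∈ A) then
        ENNReal.ofReal (Real.sinh β ^ #F₁ * Real.cosh β ^ (#G.edgeFinset - #F₁)) *
          ∑ F₂ ∈ G.edgeFinset.powerset, (if (∀ v, Odd #(F₂.filter (v ∈ ·)) ↔ v ∈ B) then
            ENNReal.ofReal (Real.sinh β ^ #F₂ * Real.cosh β ^ (#G.edgeFinset - #F₂)) * g F₁ F₂ else 0)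
        else 0 := by
  have inner : ∀ F₁ : Finset (Sym2 V),
      ∑' n₂ : Current G, (if n₂.sources = B then n₂.eweight (fun _ : G.edgeFinset => β) else 0) *
          g F₁ (oddPart n₂) =
        ∑ F₂ ∈ G.edgeFinset.powerset, (if (∀ v, Odd #(F₂.filter (v ∈ ·)) ↔ v ∈ B) then
            ENNReal.ofReal (Real.sinh β ^ #F₂ * Real.cosh β ^ (#G.edgeFinset - #F₂)) * g F₁ F₂ else 0) :=
    fun F₁ => tsum_sources_eweight_mul_apply_oddPart hβ B (g F₁)
  calc ∑' p : Current G × Current G,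
        epairWeight (fun _ : G.edgeFinset => β) A B p * g (oddPart p.1) (oddPart p.2)
      = ∑' (n₁ : Current G) (n₂ : Current G),
          (if n₁.sources = A then n₁.eweight (fun _ : G.edgeFinset => β) else 0) *
            ((if n₂.sources = B then n₂.eweight (fun _ : G.edgeFinset => β) else 0) *
              g (oddPart n₁) (oddPart n₂)) := by
        rw [ENNReal.tsum_prod']
        refine tsum_congr fun n₁ => tsum_congr fun n₂ => ?_
        rw [epairWeight_eq_mul, mul_assoc]
    _ = ∑' n₁ : Current G, (if n₁.sources = A then n₁.eweight (fun _ : G.edgeFinset => β) else 0) *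
          ∑ F₂ ∈ G.edgeFinset.powerset, (if (∀ v, Odd #(F₂.filter (v ∈ ·)) ↔ v ∈ B) then
            ENNReal.ofReal (Real.sinh β ^ #F₂ * Real.cosh β ^ (#G.edgeFinset - #F₂)) *
              g (oddPart n₁) F₂ else 0) := by
        refine tsum_congr fun n₁ => ?_
        rw [ENNReal.tsum_mul_left, inner]
    _ = _ := tsum_sources_eweight_mul_apply_oddPart hβ A (fun F₁ =>
          ∑ F₂ ∈ G.edgeFinset.powerset, (if (∀ v, Odd #(F₂.filter (v ∈ ·)) ↔ v ∈ B) then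
            ENNReal.ofReal (Real.sinh β ^ #F₂ * Real.cosh β ^ (#G.edgeFinset - #F₂)) * g F₁ F₂ else 0))

/-- Pointwise domination: the loop event `{x ↔ z in odd(n₁) ∪ odd(n₂)}` implies the current event
`{z ∈ C_{n₁+n₂}(x)}` (`odd(nᵢ) ⊆ trace(n₁ + n₂)`, landed as `coe_oddPart_subset_traced_add`). -/
theorem ite_reachable_oddParts_le (x z : V) (p : Current G × Current G) :
    (if (SimpleGraph.fromEdgeSet ((↑(oddPart p.1) : Set (Sym2 V)) ∪ ↑(oddPart p.2))).Reachable x z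
      then (1 : ℝ≥0∞) else 0) ≤ (if z ∈ (p.1 + p.2).cluster x then 1 else 0) := by
  by_cases h : (SimpleGraph.fromEdgeSet ((↑(oddPart p.1) : Set (Sym2 V)) ∪ ↑(oddPart p.2))).Reachable x z
  · have hsub : ((↑(oddPart p.1) : Set (Sym2 V)) ∪ ↑(oddPart p.2)) ⊆ (p.1 + p.2).traced := by
      refine Set.union_subset (coe_oddPart_subset_traced_add p.1 p.2) ?_
      rw [add_comm]
      exact coe_oddPart_subset_traced_add p.2 p.1
    have hle : SimpleGraph.fromEdgeSet ((↑(oddPart p.1) : Set (Sym2 V)) ∪ ↑(oddPart p.2)) ≤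
        Literature.Probability.Percolation.openGraph (p.1 + p.2).traced :=
      SimpleGraph.fromEdgeSet_mono hsub
    rw [if_pos h, if_pos (Current.mem_cluster_iff.2 (h.mono hle))]
  · rw [if_neg h]
    exact bot_le

/-- Finite bookkeeping: the iterated `sinh/cosh` sum of the loop event is `cosh(β)^{2|E|}` times the
joint `tanh` sum `J_t` of the crux (over `tJoins`). -/
theorem sum_oddParts_reachable_eq {β : ℝ} (hβ : 0 ≤ β) (A B : Finset V) (x z : V) :
    (∑ F₁ ∈ G.edgeFinset.powerset, if (∀ v, Odd #(F₁.filter (v ∈ ·)) ↔ v ∈ A) then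
        ENNReal.ofReal (Real.sinh β ^ #F₁ * Real.cosh β ^ (#G.edgeFinset - #F₁)) *
          ∑ F₂ ∈ G.edgeFinset.powerset, (if (∀ v, Odd #(F₂.filter (v ∈ ·)) ↔ v ∈ B) then
            ENNReal.ofReal (Real.sinh β ^ #F₂ * Real.cosh β ^ (#G.edgeFinset - #F₂)) *
              (if (SimpleGraph.fromEdgeSet ((↑F₁ : Set (Sym2 V)) ∪ ↑F₂)).Reachable x z
                then (1 : ℝ≥0∞) else 0) else 0)
        else 0) =
      ENNReal.ofReal (Real.cosh β ^ #G.edgeFinset * Real.cosh β ^ #G.edgeFinset *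
        ∑ F₁ ∈ tJoins G Set.univ A, ∑ F₂ ∈ tJoins G Set.univ B,
          if (SimpleGraph.fromEdgeSet ((↑F₁ : Set (Sym2 V)) ∪ ↑F₂)).Reachable x z
          then Real.tanh β ^ (#F₁ + #F₂) else 0) := by
  have ht : 0 ≤ Real.tanh β := by
    rw [Real.tanh_eq_sinh_div_cosh]
    exact div_nonneg (Real.sinh_nonneg_iff.2 hβ) (Real.cosh_pos β).le
  have hc : 0 < Real.cosh β := Real.cosh_pos β
  -- rewrite the right-hand side as an iterated sum of `ofReal`s over the powerset with indicators
  have hR : ENNReal.ofReal (Real.cosh β ^ #G.edgeFinset * Real.cosh β ^ #G.edgeFinset *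
        ∑ F₁ ∈ tJoins G Set.univ A, ∑ F₂ ∈ tJoins G Set.univ B,
          if (SimpleGraph.fromEdgeSet ((↑F₁ : Set (Sym2 V)) ∪ ↑F₂)).Reachable x z
          then Real.tanh β ^ (#F₁ + #F₂) else 0) =
      ∑ F₁ ∈ tJoins G Set.univ A, ∑ F₂ ∈ tJoins G Set.univ B,
        ENNReal.ofReal (Real.cosh β ^ #G.edgeFinset * Real.cosh β ^ #G.edgeFinset *
          if (SimpleGraph.fromEdgeSet ((↑F₁ : Set (Sym2 V)) ∪ ↑F₂)).Reachable x z
          then Real.tanh β ^ (#F₁ + #F₂) else 0) := by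
    rw [Finset.mul_sum, ENNReal.ofReal_sum_of_nonneg (fun F₁ _ => by positivity)]
    refine Finset.sum_congr rfl fun F₁ _ => ?_
    rw [Finset.mul_sum, ENNReal.ofReal_sum_of_nonneg (fun F₂ _ => by positivity)]
  rw [hR, tJoins, Finset.sum_filter]
  refine Finset.sum_congr rfl fun F₁ hF₁ => ?_
  have hle₁ : #F₁ ≤ #G.edgeFinset := Finset.card_le_card (Finset.mem_powerset.1 hF₁)
  by_cases hA : (∀ v, Odd #(F₁.filter (v ∈ ·)) ↔ v ∈ A)
  · have hA' : (↑F₁ : Set (Sym2 V)) ⊆ Set.univ ∧ (∀ v, Odd #(F₁.filter (v ∈ ·)) ↔ v ∈ A) :=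
      ⟨Set.subset_univ _, hA⟩
    rw [if_pos hA, if_pos hA', tJoins, Finset.sum_filter, Finset.mul_sum]
    refine Finset.sum_congr rfl fun F₂ hF₂ => ?_
    have hle₂ : #F₂ ≤ #G.edgeFinset := Finset.card_le_card (Finset.mem_powerset.1 hF₂)
    by_cases hB : (∀ v, Odd #(F₂.filter (v ∈ ·)) ↔ v ∈ B)
    · have hB' : (↑F₂ : Set (Sym2 V)) ⊆ Set.univ ∧ (∀ v, Odd #(F₂.filter (v ∈ ·)) ↔ v ∈ B) :=
        ⟨Set.subset_univ _, hB⟩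
      rw [if_pos hB, if_pos hB']
      by_cases hxz : (SimpleGraph.fromEdgeSet ((↑F₁ : Set (Sym2 V)) ∪ ↑F₂)).Reachable x z
      · rw [if_pos hxz, if_pos hxz, mul_one, sinh_pow_mul_cosh_pow_sub β hle₁,
          sinh_pow_mul_cosh_pow_sub β hle₂,
          ← ENNReal.ofReal_mul (by positivity)]
        congr 1
        ring
      · rw [if_neg hxz, if_neg hxz, mul_zero, mul_zero, mul_zero, ENNReal.ofReal_zero]
    · have hB' : ¬ ((↑F₂ : Set (Sym2 V)) ⊆ Set.univ ∧ (∀ v, Odd #(F₂.filter (v ∈ ·)) ↔ v ∈ B)) :=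
        fun h => hB h.2
      rw [if_neg hB, if_neg hB', mul_zero]
  · have hA' : ¬ ((↑F₁ : Set (Sym2 V)) ⊆ Set.univ ∧ (∀ v, Odd #(F₁.filter (v ∈ ·)) ↔ v ∈ A)) :=
      fun h => hA h.2
    rw [if_neg hA, if_neg hA']

/-- **FIRST LEMMA (b) — domination of the double-current connection sum by the joint loop sum**:
`cosh(β)^{2|E|} · J_t(A,B; x ↔ z) ≤ P := Σ 1{∂n₁=A}1{∂n₂=B} w w 1[z ∈ C_{n₁+n₂}(x)]`.
This is the step "two INDEPENDENT sourced loop-O(1) configurations joining `x` to `z` force the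
double-current connection" of the crux, as an inequality of `ℝ≥0∞` sums on an arbitrary finite graph. -/
theorem loopPair_le_doubleCurrent {β : ℝ} (hβ : 0 ≤ β) (A B : Finset V) (x z : V) :
    ENNReal.ofReal (Real.cosh β ^ #G.edgeFinset * Real.cosh β ^ #G.edgeFinset *
      ∑ F₁ ∈ tJoins G Set.univ A, ∑ F₂ ∈ tJoins G Set.univ B,
        if (SimpleGraph.fromEdgeSet ((↑F₁ : Set (Sym2 V)) ∪ ↑F₂)).Reachable x z
        then Real.tanh β ^ (#F₁ + #F₂) else 0) ≤
    ∑' p : Current G × Current G, epairWeight (fun _ : G.edgeFinset => β) A B p *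
      (if z ∈ (p.1 + p.2).cluster x then 1 else 0) := by
  have hpush := tsum_epairWeight_mul_apply_oddParts (G := G) hβ A B
    (fun F₁ F₂ => if (SimpleGraph.fromEdgeSet ((↑F₁ : Set (Sym2 V)) ∪ ↑F₂)).Reachable x z
      then (1 : ℝ≥0∞) else 0)
  rw [← sum_oddParts_reachable_eq hβ A B x z, ← hpush]
  exact ENNReal.tsum_le_tsum fun p => mul_le_mul' le_rfl (ite_reachable_oddParts_le x z p)

/-- **The loop-dressed Aizenman inequality** (ℝ≥0∞ current sums; the two-sourced analogue of the
landed `currentSum_four_add_oddPart_le`): with `Z[S] = ecurrentSum (fun _ => β) S`,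
`D = {a₀}∆{a₁}∆{a₂}∆{a₃}` and `J_t` the joint loop sum of the crux,
`Z[D]Z[∅] + 2 cosh^{2|E|} J_t ≤ Z[01]Z[23] + Z[02]Z[13] + Z[03]Z[12]`. -/
theorem currentSum_four_add_loopPair_le {β : ℝ} (hβ : 0 ≤ β) (a : Fin 4 → V) :
    ecurrentSum (fun _ : G.edgeFinset => β) ({a 0} ∆ ({a 1} ∆ ({a 2} ∆ {a 3}))) *
        ecurrentSum (fun _ : G.edgeFinset => β) ∅ +
      2 * ENNReal.ofReal (Real.cosh β ^ #G.edgeFinset * Real.cosh β ^ #G.edgeFinset *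
        ∑ F₁ ∈ tJoins G Set.univ ({a 0} ∆ {a 1}), ∑ F₂ ∈ tJoins G Set.univ ({a 2} ∆ {a 3}),
          if (SimpleGraph.fromEdgeSet ((↑F₁ : Set (Sym2 V)) ∪ ↑F₂)).Reachable (a 0) (a 2)
          then Real.tanh β ^ (#F₁ + #F₂) else 0) ≤
    ecurrentSum (fun _ : G.edgeFinset => β) ({a 0} ∆ {a 1}) * ecurrentSum (fun _ : G.edgeFinset => β) ({a 2} ∆ {a 3}) +
      ecurrentSum (fun _ : G.edgeFinset => β) ({a 0} ∆ {a 2}) * ecurrentSum (fun _ : G.edgeFinset => β) ({a 1} ∆ {a 3}) +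
      ecurrentSum (fun _ : G.edgeFinset => β) ({a 0} ∆ {a 3}) * ecurrentSum (fun _ : G.edgeFinset => β) ({a 1} ∆ {a 2}) := by
  rw [Current.ursellFour_currentSum_identity (K := fun _ => β) (fun _ => hβ) (a 0) (a 1) (a 2) (a 3)]
  exact add_le_add le_rfl (mul_le_mul' le_rfl (loopPair_le_doubleCurrent hβ _ _ (a 0) (a 2)))

/-- The route's support item `StrandsJoinBound` (stmt-CriticalPhenomena-14647), verbatim (primed copy):
the `ℝ`-form `U₄^free_G(a)·Z_t(∅)² ≤ −2 J_t(a)` of `currentSum_four_add_loopPair_le` — obtained from it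
by `toReal` (all sums finite: `ecurrentSum_ne_top`), `Z[S] = cosh^{|E|} Z_t(S)`
(`tsum_sources_eweight_mul_apply_oddPart` with `g = 1`, `ecurrentSum_empty_eq_ofReal`), the dictionary
`⟨σ_S⟩^free = Z[S]/Z[∅]` (`isingCorr_free_eq_currentSum_div_holds`, `currentSum_eq_wcurrentSum`,
`toReal_ecurrentSum`) and `σ_{a₀}σ_{a₁}σ_{a₂}σ_{a₃} = σ_D` (`isingExpect_spinMonomial_four_eq`). -/
def StrandsJoinBound' : Prop :=
  ∀ (V : Type) [Fintype V] [DecidableEq V] (G : SimpleGraph V) [DecidableRel G.Adj] (β : ℝ), 0 ≤ β →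
    ∀ a : Fin 4 → V, Function.Injective a → (let t : ℝ := Real.tanh β;
      Literature.Probability.LatticeModels.connectedFour
          (Literature.Probability.LatticeModels.isingMeasure G Finset.univ β 0 .free)
          Literature.Probability.LatticeModels.spinAt a *
        (Literature.Probability.LatticeModels.loopO1PartitionFunction G t ∅) ^ 2 ≤
      -(2 * ∑ F₁ ∈ Literature.Probability.LatticeModels.tJoins G Set.univ {a 0, a 1},
        ∑ F₂ ∈ Literature.Probability.LatticeModels.tJoins G Set.univ {a 2, a 3},
          if (SimpleGraph.fromEdgeSet ((↑F₁ : Set (Sym2 V)) ∪ ↑F₂)).Reachable (a 0) (a 2)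
          then t ^ (F₁.card + F₂.card) else 0))

/-! ### From `ℝ≥0∞` current sums to the route's `ℝ` statement `StrandsJoinBound` -/

/-- Reading an `ℝ≥0∞` inequality between `ofReal`s of nonnegative reals back in `ℝ`. -/
theorem real_le_of_ofReal_combo {x y w u v p q r s : ℝ} (hx : 0 ≤ x) (hy : 0 ≤ y) (hw : 0 ≤ w)
    (hu : 0 ≤ u) (hv : 0 ≤ v) (hp : 0 ≤ p) (hq : 0 ≤ q) (hr : 0 ≤ r) (hs : 0 ≤ s)
    (h : ENNReal.ofReal x * ENNReal.ofReal y + 2 * ENNReal.ofReal w ≤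
      ENNReal.ofReal u * ENNReal.ofReal v + ENNReal.ofReal p * ENNReal.ofReal q +
        ENNReal.ofReal r * ENNReal.ofReal s) :
    x * y + 2 * w ≤ u * v + p * q + r * s := by
  have h2 : (2 : ℝ≥0∞) = ENNReal.ofReal 2 := by norm_num
  rw [h2, ← ENNReal.ofReal_mul hx, ← ENNReal.ofReal_mul (by norm_num : (0:ℝ) ≤ 2),
    ← ENNReal.ofReal_mul hu, ← ENNReal.ofReal_mul hp, ← ENNReal.ofReal_mul hr,
    ← ENNReal.ofReal_add (mul_nonneg hx hy) (by positivity),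
    ← ENNReal.ofReal_add (mul_nonneg hu hv) (mul_nonneg hp hq),
    ← ENNReal.ofReal_add (by positivity) (mul_nonneg hr hs)] at h
  exact (ENNReal.ofReal_le_ofReal_iff (by positivity)).1 h

omit [Fintype V] [DecidableRel G.Adj] in
/-- `{u} ∆ {v} = {u, v}` for `u ≠ v`. [folklore] -/
theorem singleton_symmDiff_singleton {u v : V} (huv : u ≠ v) : ({u} : Finset V) ∆ {v} = {u, v} := by
  rw [Finset.symmDiff_eq_union (Finset.disjoint_singleton.mpr huv)]
  rfl

/-- The sourceless loop-O(1) partition function is the `tanh`-sum over even subgraphs. -/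
theorem loopO1PartitionFunction_empty_eq_sum (t : ℝ) :
    loopO1PartitionFunction G t ∅ = ∑ F ∈ evenSubgraphs G Set.univ, t ^ #F := by
  unfold loopO1PartitionFunction loopO1Weight
  rw [← Finset.sum_filter, Finset.filter_mem_eq_inter,
    Finset.inter_eq_right.2 (fun F hF => Finset.mem_powerset.2 ((mem_tJoins G).1 hF).1)]

/-- `Z_β[∅] = cosh(β)^{|E|} · Z_t(∅)` in `ℝ` (`ecurrentSum_empty_eq_ofReal` read back). -/
theorem currentSum_empty_eq_cosh_pow_mul {β : ℝ} (hβ : 0 ≤ β) :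
    currentSum G β ∅ = Real.cosh β ^ #G.edgeFinset * loopO1PartitionFunction G (Real.tanh β) ∅ := by
  have hK : ∀ _e : G.edgeFinset, 0 ≤ β := fun _ => hβ
  have ht : 0 ≤ Real.tanh β := by
    rw [Real.tanh_eq_sinh_div_cosh]
    exact div_nonneg (Real.sinh_nonneg_iff.2 hβ) (Real.cosh_pos β).le
  have h := ecurrentSum_empty_eq_ofReal (G := G) hβ
  rw [ecurrentSum_eq_ofReal hK, ENNReal.ofReal_eq_ofReal_iff (wcurrentSum_nonneg hK _)
    (by positivity)] at h
  rw [loopO1PartitionFunction_empty_eq_sum]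
  exact h

/-- **The `ℝ` form `U₄^free_G(a)·Z_t(∅)² ≤ −2 J_t(a)`** (body of the route's `StrandsJoinBound`):
the `ℝ`-reading of `currentSum_four_add_loopPair_le` through the dictionary
`⟨σ_S⟩^free = Z[S]/Z[∅]`, `Z[∅] = cosh^{|E|} Z_t(∅)`. -/
theorem connectedFour_mul_sq_le {β : ℝ} (hβ : 0 ≤ β) (a : Fin 4 → V) (ha : Function.Injective a) :
    connectedFour (isingMeasure G Finset.univ β 0 .free) spinAt a *
        (loopO1PartitionFunction G (Real.tanh β) ∅) ^ 2 ≤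
      -(2 * ∑ F₁ ∈ tJoins G Set.univ {a 0, a 1}, ∑ F₂ ∈ tJoins G Set.univ {a 2, a 3},
          if (SimpleGraph.fromEdgeSet ((↑F₁ : Set (Sym2 V)) ∪ ↑F₂)).Reachable (a 0) (a 2)
          then Real.tanh β ^ (F₁.card + F₂.card) else 0) := by
  have hK : ∀ _e : G.edgeFinset, 0 ≤ β := fun _ => hβ
  have hc : 0 < Real.cosh β := Real.cosh_pos β
  have ht : 0 ≤ Real.tanh β := by
    rw [Real.tanh_eq_sinh_div_cosh]
    exact div_nonneg (Real.sinh_nonneg_iff.2 hβ) (Real.cosh_pos β).le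
  have hzt : 0 < loopO1PartitionFunction G (Real.tanh β) ∅ := loopO1PartitionFunction_empty_pos G ht
  -- the six pairs as two-element sets
  have p01 := singleton_symmDiff_singleton (ha.ne (show (0 : Fin 4) ≠ 1 by decide))
  have p23 := singleton_symmDiff_singleton (ha.ne (show (2 : Fin 4) ≠ 3 by decide))
  have p02 := singleton_symmDiff_singleton (ha.ne (show (0 : Fin 4) ≠ 2 by decide))
  have p13 := singleton_symmDiff_singleton (ha.ne (show (1 : Fin 4) ≠ 3 by decide))
  have p03 := singleton_symmDiff_singleton (ha.ne (show (0 : Fin 4) ≠ 3 by decide))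
  have p12 := singleton_symmDiff_singleton (ha.ne (show (1 : Fin 4) ≠ 2 by decide))
  -- (E1): the loop-dressed Aizenman inequality, `ℝ≥0∞`
  have E1 := currentSum_four_add_loopPair_le (G := G) hβ a
  have e : ∀ S : Finset V, ecurrentSum (fun _ : G.edgeFinset => β) S = ENNReal.ofReal (currentSum G β S) :=
    fun S => ecurrentSum_eq_ofReal hK S
  simp only [e, p01, p23, p02, p13, p03, p12] at E1
  -- (E2): read back in `ℝ`
  have hJ : 0 ≤ ∑ F₁ ∈ tJoins G Set.univ {a 0, a 1}, ∑ F₂ ∈ tJoins G Set.univ {a 2, a 3},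
      (if (SimpleGraph.fromEdgeSet ((↑F₁ : Set (Sym2 V)) ∪ ↑F₂)).Reachable (a 0) (a 2)
        then Real.tanh β ^ (#F₁ + #F₂) else 0) :=
    Finset.sum_nonneg fun F₁ _ => Finset.sum_nonneg fun F₂ _ => by split_ifs <;> positivity
  have hZ0 : ∀ S : Finset V, 0 ≤ currentSum G β S := fun S => currentSum_nonneg G hβ S
  have E2 := real_le_of_ofReal_combo (hZ0 _) (hZ0 _) (by positivity) (hZ0 _) (hZ0 _) (hZ0 _) (hZ0 _)
    (hZ0 _) (hZ0 _) E1
  -- `U₄` through the dictionary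
  have h2 := isingTwoPoint_free_eq_currentSum_div_holds G β
  have hmono : spinMonomial a = spinMonomial ![a 0, a 1, a 2, a 3] := by
    congr 1
    funext i
    fin_cases i <;> rfl
  have hU : connectedFour (isingMeasure G Finset.univ β 0 .free) spinAt a =
      currentSum G β ({a 0} ∆ ({a 1} ∆ ({a 2} ∆ {a 3}))) / currentSum G β ∅
        - currentSum G β {a 0, a 1} / currentSum G β ∅ * (currentSum G β {a 2, a 3} / currentSum G β ∅)
        - currentSum G β {a 0, a 2} / currentSum G β ∅ * (currentSum G β {a 1, a 3} / currentSum G β ∅)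
        - currentSum G β {a 0, a 3} / currentSum G β ∅ * (currentSum G β {a 1, a 2} / currentSum G β ∅) := by
    simp only [connectedFour, nPoint_isingMeasure, twoPoint_isingMeasure]
    rw [hmono, isingExpect_spinMonomial_four_eq, h2 (a 0) (a 1), h2 (a 2) (a 3), h2 (a 0) (a 2),
      h2 (a 1) (a 3), h2 (a 0) (a 3), h2 (a 1) (a 2), p01, p23, p02, p13, p03, p12]
  -- the algebra: `Z[∅] = cosh^{|E|} Z_t(∅)`, divide (E2) by `cosh^{2|E|}`
  have hZ := currentSum_empty_eq_cosh_pow_mul (G := G) hβ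
  rw [hU, hZ, p23]
  rw [hZ] at E2
  have hcm : 0 < Real.cosh β ^ #G.edgeFinset := pow_pos hc _
  have key : (currentSum G β ({a 0} ∆ ({a 1} ∆ {a 2, a 3})) /
          (Real.cosh β ^ #G.edgeFinset * loopO1PartitionFunction G (Real.tanh β) ∅) -
        currentSum G β {a 0, a 1} / (Real.cosh β ^ #G.edgeFinset * loopO1PartitionFunction G (Real.tanh β) ∅) *
          (currentSum G β {a 2, a 3} / (Real.cosh β ^ #G.edgeFinset * loopO1PartitionFunction G (Real.tanh β) ∅)) -
        currentSum G β {a 0, a 2} / (Real.cosh β ^ #G.edgeFinset * loopO1PartitionFunction G (Real.tanh β) ∅) *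
          (currentSum G β {a 1, a 3} / (Real.cosh β ^ #G.edgeFinset * loopO1PartitionFunction G (Real.tanh β) ∅)) -
        currentSum G β {a 0, a 3} / (Real.cosh β ^ #G.edgeFinset * loopO1PartitionFunction G (Real.tanh β) ∅) *
          (currentSum G β {a 1, a 2} / (Real.cosh β ^ #G.edgeFinset * loopO1PartitionFunction G (Real.tanh β) ∅))) *
        loopO1PartitionFunction G (Real.tanh β) ∅ ^ 2 =
      (currentSum G β ({a 0} ∆ ({a 1} ∆ {a 2, a 3})) *
          (Real.cosh β ^ #G.edgeFinset * loopO1PartitionFunction G (Real.tanh β) ∅) -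
        (currentSum G β {a 0, a 1} * currentSum G β {a 2, a 3} +
          currentSum G β {a 0, a 2} * currentSum G β {a 1, a 3} +
          currentSum G β {a 0, a 3} * currentSum G β {a 1, a 2})) /
        (Real.cosh β ^ #G.edgeFinset * Real.cosh β ^ #G.edgeFinset) := by
    field_simp
    ring
  rw [key, div_le_iff₀ (by positivity)]
  linarith [E2]

/-- **`StrandsJoinBound` holds** (the route's support item 14647, primed copy; `V : Type`). -/
theorem strandsJoinBound' : StrandsJoinBound' :=
  fun _ _ _ G _ _ hβ a ha => connectedFour_mul_sq_le (G := G) hβ a ha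

/-! ### The `cosh` dictionary for every source set and the consumer of the crux hypothesis -/

/-- `Z_t(S)` as the `tanh`-sum over `T`-joins. -/
theorem loopO1PartitionFunction_eq_sum (t : ℝ) (S : Finset V) :
    loopO1PartitionFunction G t S = ∑ F ∈ tJoins G Set.univ S, t ^ #F := by
  unfold loopO1PartitionFunction loopO1Weight
  rw [← Finset.sum_filter, Finset.filter_mem_eq_inter,
    Finset.inter_eq_right.2 (fun F hF => Finset.mem_powerset.2 ((mem_tJoins G).1 hF).1)]

/-- **`Z_β[S] = cosh(β)^{|E|} · Z_t(S)`** for every source set `S` (the odd-part pushforward with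
`g ≡ 1`, read back in `ℝ`). -/
theorem currentSum_eq_cosh_pow_mul {β : ℝ} (hβ : 0 ≤ β) (S : Finset V) :
    currentSum G β S = Real.cosh β ^ #G.edgeFinset * loopO1PartitionFunction G (Real.tanh β) S := by
  have hK : ∀ _e : G.edgeFinset, 0 ≤ β := fun _ => hβ
  have hc : 0 < Real.cosh β := Real.cosh_pos β
  have ht : 0 ≤ Real.tanh β := by
    rw [Real.tanh_eq_sinh_div_cosh]
    exact div_nonneg (Real.sinh_nonneg_iff.2 hβ) (Real.cosh_pos β).le
  have h := tsum_sources_eweight_mul_apply_oddPart (G := G) hβ S (fun _ => 1)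
  simp only [mul_one] at h
  have h' : ecurrentSum (fun _ : G.edgeFinset => β) S =
      ENNReal.ofReal (Real.cosh β ^ #G.edgeFinset * loopO1PartitionFunction G (Real.tanh β) S) := by
    unfold ecurrentSum
    rw [h, loopO1PartitionFunction_eq_sum, Finset.mul_sum,
      ENNReal.ofReal_sum_of_nonneg (fun F _ => by positivity), tJoins, Finset.sum_filter]
    refine Finset.sum_congr rfl fun F hF => ?_
    have hle : #F ≤ #G.edgeFinset := Finset.card_le_card (Finset.mem_powerset.1 hF)
    by_cases hS : (∀ v, Odd #(F.filter (v ∈ ·)) ↔ v ∈ S)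
    · have hS' : (↑F : Set (Sym2 V)) ⊆ Set.univ ∧ (∀ v, Odd #(F.filter (v ∈ ·)) ↔ v ∈ S) :=
        ⟨Set.subset_univ _, hS⟩
      rw [if_pos hS, if_pos hS', sinh_pow_mul_cosh_pow_sub β hle]
    · have hS' : ¬ ((↑F : Set (Sym2 V)) ⊆ Set.univ ∧ (∀ v, Odd #(F.filter (v ∈ ·)) ↔ v ∈ S)) :=
        fun h => hS h.2
      rw [if_neg hS, if_neg hS']
  rw [ecurrentSum_eq_ofReal hK, ENNReal.ofReal_eq_ofReal_iff (wcurrentSum_nonneg hK _)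
    (mul_nonneg (pow_nonneg hc.le _) (loopO1PartitionFunction_nonneg G ht S))] at h'
  exact h'

/-- **The consumer of the crux hypothesis on one finite graph**: if two independent sourced loop-O(1)
configurations join `a₀` to `a₂` with joint mass `≥ c·Z_t(01)Z_t(23)` (the crux inequality at one
box), then `U₄(a) ≤ −2c ⟨σ_{a₀}σ_{a₁}⟩⟨σ_{a₂}σ_{a₃}⟩` in the free state of that graph. -/
theorem connectedFour_le_of_loopJoin {β : ℝ} (hβ : 0 ≤ β) (a : Fin 4 → V) (ha : Function.Injective a)
    {c : ℝ}
    (hJ : c * loopO1PartitionFunction G (Real.tanh β) {a 0, a 1} *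
        loopO1PartitionFunction G (Real.tanh β) {a 2, a 3} ≤
      ∑ F₁ ∈ tJoins G Set.univ {a 0, a 1}, ∑ F₂ ∈ tJoins G Set.univ {a 2, a 3},
        if (SimpleGraph.fromEdgeSet ((↑F₁ : Set (Sym2 V)) ∪ ↑F₂)).Reachable (a 0) (a 2)
        then Real.tanh β ^ (#F₁ + #F₂) else 0) :
    connectedFour (isingMeasure G Finset.univ β 0 .free) spinAt a ≤
      -(2 * c * (isingTwoPoint G Finset.univ β 0 .free (a 0) (a 1) *
        isingTwoPoint G Finset.univ β 0 .free (a 2) (a 3))) := by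
  have hS := connectedFour_mul_sq_le (G := G) hβ a ha
  have ht : 0 ≤ Real.tanh β := by
    rw [Real.tanh_eq_sinh_div_cosh]
    exact div_nonneg (Real.sinh_nonneg_iff.2 hβ) (Real.cosh_pos β).le
  have hzt : 0 < loopO1PartitionFunction G (Real.tanh β) ∅ := loopO1PartitionFunction_empty_pos G ht
  have hcm : 0 < Real.cosh β ^ #G.edgeFinset := pow_pos (Real.cosh_pos β) _
  have h2 := isingTwoPoint_free_eq_currentSum_div_holds G β
  rw [h2 (a 0) (a 1), h2 (a 2) (a 3),
    singleton_symmDiff_singleton (ha.ne (show (0 : Fin 4) ≠ 1 by decide)),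
    singleton_symmDiff_singleton (ha.ne (show (2 : Fin 4) ≠ 3 by decide)),
    currentSum_eq_cosh_pow_mul hβ {a 0, a 1}, currentSum_eq_cosh_pow_mul hβ {a 2, a 3},
    currentSum_eq_cosh_pow_mul hβ ∅, mul_div_mul_left _ _ hcm.ne', mul_div_mul_left _ _ hcm.ne']
  have key : connectedFour (isingMeasure G Finset.univ β 0 .free) spinAt a *
      loopO1PartitionFunction G (Real.tanh β) ∅ ^ 2 ≤
        -(2 * c * (loopO1PartitionFunction G (Real.tanh β) {a 0, a 1} *
          loopO1PartitionFunction G (Real.tanh β) {a 2, a 3})) := by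
    linarith [hS, hJ]
  have hr : -(2 * c * (loopO1PartitionFunction G (Real.tanh β) {a 0, a 1} /
        loopO1PartitionFunction G (Real.tanh β) ∅ *
        (loopO1PartitionFunction G (Real.tanh β) {a 2, a 3} / loopO1PartitionFunction G (Real.tanh β) ∅))) =
      -(2 * c * (loopO1PartitionFunction G (Real.tanh β) {a 0, a 1} *
          loopO1PartitionFunction G (Real.tanh β) {a 2, a 3})) /
        loopO1PartitionFunction G (Real.tanh β) ∅ ^ 2 := by
    field_simp
  rw [hr, le_div_iff₀ (pow_pos hzt 2)]
  exact key

/-! ### Read-back against the route file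

`StrandsJoinBound'` is the verbatim text of the route's support item `StrandsJoinBound`
(stmt-CriticalPhenomena-14647, rev 7 of the route file); the farm's build of the route module may
predate that item, so the `Iff.rfl` read-back is left to the prover who lands it. -/

end FiniteGraph



section Box

/-- **Transport (box step of the bridge)**: the free correlations of the comap graph
`G_N = (zdGraph 3).comap Subtype.val` on `↥(box 3 N)` (the crux's `let G`) are the free box
correlations of `ℤ³` in `Λ_N = box 3 N` — the language of `criticalCorr_wellDefined_holds`. One line from
the tree's `isingCorr_free_map` (graph-isomorphism invariance of the free state). -/
theorem isingCorr_boxGraph_univ_eq (N : ℕ) (β : ℝ) (A : Finset ↥(box 3 N)) :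
    isingCorr ((zdGraph 3).comap (Subtype.val : ↥(box 3 N) → Site 3)) Finset.univ β 0 .free A =
      isingCorr (zdGraph 3) (box 3 N) β 0 .free (A.map (Function.Embedding.subtype _)) := by
  have h := isingCorr_free_map (G := (zdGraph 3).comap (Subtype.val : ↥(box 3 N) → Site 3))
    (G' := zdGraph 3) (Function.Embedding.subtype (· ∈ box 3 N)) (Λ := Finset.univ)
    (fun x _ y _ => Iff.rfl) β 0 A
  rw [← h]
  congr 1
  rw [Finset.univ_eq_attach, Finset.attach_map_val]

/-- **Limit step of the bridge** (from boxes to the critical state): an inequality between finite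
combinations of free box correlations that holds for all large `N` passes to `criticalCorr 3`
(`criticalCorr_wellDefined_holds`: free box limits = the critical plus state in `d = 3`, continuity at
`β_c`). Stated for the `U₄ ≤ −c·G·G` combination at four sites `x`. -/
def BoxToCritical : Prop :=
  ∀ (c : ℝ) (x : Fin 4 → Site 3), Function.Injective x →
    (∃ N₀ : ℕ, ∀ N : ℕ, N₀ ≤ N →
      isingExpect (zdGraph 3) (box 3 N) (criticalBeta 3) 0 .free (spinMonomial x)
        - (isingExpect (zdGraph 3) (box 3 N) (criticalBeta 3) 0 .free (spinMonomial ![x 0, x 1]) *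
            isingExpect (zdGraph 3) (box 3 N) (criticalBeta 3) 0 .free (spinMonomial ![x 2, x 3])
          + isingExpect (zdGraph 3) (box 3 N) (criticalBeta 3) 0 .free (spinMonomial ![x 0, x 2]) *
            isingExpect (zdGraph 3) (box 3 N) (criticalBeta 3) 0 .free (spinMonomial ![x 1, x 3])
          + isingExpect (zdGraph 3) (box 3 N) (criticalBeta 3) 0 .free (spinMonomial ![x 0, x 3]) *
            isingExpect (zdGraph 3) (box 3 N) (criticalBeta 3) 0 .free (spinMonomial ![x 1, x 2])) ≤
      -(c * (isingExpect (zdGraph 3) (box 3 N) (criticalBeta 3) 0 .free (spinMonomial ![x 0, x 1]) *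
        isingExpect (zdGraph 3) (box 3 N) (criticalBeta 3) 0 .free (spinMonomial ![x 2, x 3])))) →
    criticalCorr 3 4 x - (criticalCorr 3 2 ![x 0, x 1] * criticalCorr 3 2 ![x 2, x 3]
        + criticalCorr 3 2 ![x 0, x 2] * criticalCorr 3 2 ![x 1, x 3]
        + criticalCorr 3 2 ![x 0, x 3] * criticalCorr 3 2 ![x 1, x 2]) ≤
      -(c * (criticalCorr 3 2 ![x 0, x 1] * criticalCorr 3 2 ![x 2, x 3]))

/-- `BoxToCritical` holds: limits of the seven box sequences exist (`criticalCorr_wellDefined_holds`,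
free boundary condition) and a closed inequality that holds eventually passes to the limit. -/
theorem boxToCritical : BoxToCritical := by
  intro c x hx h
  obtain ⟨N₀, hN⟩ := h
  have hd : (3 : ℕ) ≤ 3 := le_rfl
  have hfree : (BoundaryCondition.free : BoundaryCondition (Site 3)) ∈
      ({.free, .plus, .minus} : Set (BoundaryCondition (Site 3))) := by simp
  have L : ∀ {n : ℕ} (y : Fin n → Site 3), Tendsto (fun N : ℕ =>
      isingExpect (zdGraph 3) (box 3 N) (criticalBeta 3) 0 .free (spinMonomial y)) atTop
        (𝓝 (criticalCorr 3 n y)) := fun y => criticalCorr_wellDefined_holds hd _ y _ hfree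
  have hlhs := (L x).sub (((L ![x 0, x 1]).mul (L ![x 2, x 3])).add ((L ![x 0, x 2]).mul (L ![x 1, x 3]))
    |>.add ((L ![x 0, x 3]).mul (L ![x 1, x 2])))
  have hrhs := ((L ![x 0, x 1]).mul (L ![x 2, x 3])).const_mul c |>.neg
  exact le_of_tendsto_of_tendsto hlhs hrhs (Filter.eventually_atTop.2 ⟨N₀, fun N hN' => hN N hN'⟩)

end Box

section Transport

/-- `univ.map val = s` for the subtype of a finset. [folklore] -/
theorem univ_map_subtype {α : Type*} (t : Finset α) :
    (Finset.univ : Finset ↥t).map (Function.Embedding.subtype _) = t := by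
  rw [Finset.univ_eq_attach, Finset.attach_map_val]

/-- A spin monomial at an injective configuration is a spin product. [folklore] -/
theorem spinMonomial_eq_spinProduct_image {W : Type*} [DecidableEq W] {n : ℕ} (x : Fin n → W)
    (hx : Function.Injective x) : spinMonomial x = spinProduct (Finset.univ.image x) := by
  funext s
  unfold spinMonomial spinProduct
  rw [Finset.prod_image (fun i _ j _ h => hx h)]

/-- `σ_uσ_v = ∏ over ![u, v]`. [folklore] -/
theorem spinPair_eq_spinMonomial {W : Type*} (u v : W) : spinPair u v = spinMonomial ![u, v] := by
  funext s
  simp [spinPair, spinMonomial, Fin.prod_univ_two]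

/-- Transport of the two-point function from the crux's comap graph `G_N` to the free box of `ℤ³`. -/
theorem isingTwoPoint_boxGraph_eq (N : ℕ) (β : ℝ) {u v : Site 3} (hu : u ∈ box 3 N) (hv : v ∈ box 3 N) :
    isingTwoPoint ((zdGraph 3).comap (Subtype.val : ↥(box 3 N) → Site 3)) Finset.univ β 0 .free
        ⟨u, hu⟩ ⟨v, hv⟩ =
      isingExpect (zdGraph 3) (box 3 N) β 0 .free (spinMonomial ![u, v]) := by
  have h := isingTwoPoint_free_map (G := (zdGraph 3).comap (Subtype.val : ↥(box 3 N) → Site 3))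
    (G' := zdGraph 3) (Function.Embedding.subtype (· ∈ box 3 N)) (Λ := Finset.univ)
    (fun x _ y _ => Iff.rfl) β 0 ⟨u, hu⟩ ⟨v, hv⟩
  rw [univ_map_subtype] at h
  rw [← h, ← spinPair_eq_spinMonomial]
  rfl

/-- Transport of the four-point function (as a spin monomial) from `G_N` to the free box of `ℤ³`. -/
theorem isingExpect_spinMonomial_boxGraph_eq (N : ℕ) (β : ℝ) (x : Fin 4 → Site 3)
    (hx : Function.Injective x) (hmem : ∀ i, x i ∈ box 3 N) :
    isingExpect ((zdGraph 3).comap (Subtype.val : ↥(box 3 N) → Site 3)) Finset.univ β 0 .free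
        (spinMonomial (fun i => (⟨x i, hmem i⟩ : ↥(box 3 N)))) =
      isingExpect (zdGraph 3) (box 3 N) β 0 .free (spinMonomial x) := by
  have ha : Function.Injective (fun i => (⟨x i, hmem i⟩ : ↥(box 3 N))) :=
    fun i j h => hx (congrArg Subtype.val h)
  rw [spinMonomial_eq_spinProduct_image _ ha, spinMonomial_eq_spinProduct_image _ hx]
  have h := isingCorr_boxGraph_univ_eq N β (Finset.univ.image fun i => (⟨x i, hmem i⟩ : ↥(box 3 N)))
  rw [Finset.map_eq_image, Finset.image_image] at h
  exact h

/-- **Box step**: the crux inequality at one box `Λ_N` (for the sites `x i ∈ Λ_N`, constant `c`)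
gives the free box inequality `U₄_{Λ_N}(x) ≤ −2c ⟨σσ⟩_{Λ_N}⟨σσ⟩_{Λ_N}` of `ℤ³`, in the spelling of
`BoxToCritical`. -/
theorem boxIneq_of_loopJoin (N : ℕ) (x : Fin 4 → Site 3) (hx : Function.Injective x)
    (hmem : ∀ i, x i ∈ box 3 N) {c : ℝ}
    (hloop : let G := ((zdGraph 3).comap (Subtype.val : ↥(box 3 N) → Site 3));
      let t : ℝ := Real.tanh (criticalBeta 3);
      let a : Fin 4 → ↥(box 3 N) := fun i => ⟨x i, hmem i⟩;
      c * loopO1PartitionFunction G t {a 0, a 1} * loopO1PartitionFunction G t {a 2, a 3} ≤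
        ∑ F₁ ∈ tJoins G Set.univ {a 0, a 1}, ∑ F₂ ∈ tJoins G Set.univ {a 2, a 3},
          if (SimpleGraph.fromEdgeSet ((↑F₁ : Set (Sym2 ↥(box 3 N))) ∪ ↑F₂)).Reachable (a 0) (a 2)
          then t ^ (#F₁ + #F₂) else 0) :
    isingExpect (zdGraph 3) (box 3 N) (criticalBeta 3) 0 .free (spinMonomial x)
        - (isingExpect (zdGraph 3) (box 3 N) (criticalBeta 3) 0 .free (spinMonomial ![x 0, x 1]) *
            isingExpect (zdGraph 3) (box 3 N) (criticalBeta 3) 0 .free (spinMonomial ![x 2, x 3])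
          + isingExpect (zdGraph 3) (box 3 N) (criticalBeta 3) 0 .free (spinMonomial ![x 0, x 2]) *
            isingExpect (zdGraph 3) (box 3 N) (criticalBeta 3) 0 .free (spinMonomial ![x 1, x 3])
          + isingExpect (zdGraph 3) (box 3 N) (criticalBeta 3) 0 .free (spinMonomial ![x 0, x 3]) *
            isingExpect (zdGraph 3) (box 3 N) (criticalBeta 3) 0 .free (spinMonomial ![x 1, x 2])) ≤
      -(2 * c * (isingExpect (zdGraph 3) (box 3 N) (criticalBeta 3) 0 .free (spinMonomial ![x 0, x 1]) *
        isingExpect (zdGraph 3) (box 3 N) (criticalBeta 3) 0 .free (spinMonomial ![x 2, x 3]))) := by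
  dsimp only at hloop
  have ha : Function.Injective (fun i => (⟨x i, hmem i⟩ : ↥(box 3 N))) :=
    fun i j h => hx (congrArg Subtype.val h)
  have h := connectedFour_le_of_loopJoin (G := (zdGraph 3).comap (Subtype.val : ↥(box 3 N) → Site 3))
    (criticalBeta_nonneg 3) (fun i => (⟨x i, hmem i⟩ : ↥(box 3 N))) ha hloop
  simp only [connectedFour, nPoint_isingMeasure, twoPoint_isingMeasure] at h
  rw [isingExpect_spinMonomial_boxGraph_eq N _ x hx hmem,
    isingTwoPoint_boxGraph_eq N _ (hmem 0) (hmem 1), isingTwoPoint_boxGraph_eq N _ (hmem 2) (hmem 3),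
    isingTwoPoint_boxGraph_eq N _ (hmem 0) (hmem 2), isingTwoPoint_boxGraph_eq N _ (hmem 1) (hmem 3),
    isingTwoPoint_boxGraph_eq N _ (hmem 0) (hmem 3), isingTwoPoint_boxGraph_eq N _ (hmem 1) (hmem 2)] at h
  linarith [h]

end Transport

section Lattice

open Summit.CriticalPhenomena.Ising3DConformalLimit.Theses.FKParityRobustness (IndependentStrandsJoin)
open Summit.CriticalPhenomena.Ising3DConformalLimit.Cruxes.ParityRobustMerging.PlaquetteXorSurgery (tetra tetra_inj)

/-- The tetrahedral lattice bound with constant `c`: `U₄^crit(l·tetra) ≤ −c·G·G` for all `l ≥ 1`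
(the conclusion of the route's glue `LatticeBoundFromStrands`, with the route's `tetra`). -/
def TetraLatticeBound (c : ℝ) : Prop :=
  ∀ l : ℕ, 1 ≤ l →
    criticalCorr 3 4 (fun i => (l : ℤ) • tetra i)
        - (criticalCorr 3 2 ![(l : ℤ) • tetra 0, (l : ℤ) • tetra 1] * criticalCorr 3 2 ![(l : ℤ) • tetra 2, (l : ℤ) • tetra 3]
          + criticalCorr 3 2 ![(l : ℤ) • tetra 0, (l : ℤ) • tetra 2] * criticalCorr 3 2 ![(l : ℤ) • tetra 1, (l : ℤ) • tetra 3]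
          + criticalCorr 3 2 ![(l : ℤ) • tetra 0, (l : ℤ) • tetra 3] * criticalCorr 3 2 ![(l : ℤ) • tetra 1, (l : ℤ) • tetra 2]) ≤
      -(c * (criticalCorr 3 2 ![(l : ℤ) • tetra 0, (l : ℤ) • tetra 1] * criticalCorr 3 2 ![(l : ℤ) • tetra 2, (l : ℤ) • tetra 3]))

/-- The dilated tetrahedron lies in the box `Λ_N` as soon as `l ≤ N`. -/
theorem smul_tetra_mem_box {l N : ℕ} (hlN : l ≤ N) (i : Fin 4) : (l : ℤ) • tetra i ∈ box 3 N := by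
  have h1 : ∀ i j, tetra i j = 1 ∨ tetra i j = -1 := by decide
  rw [mem_box]
  intro j
  have hl : (l : ℤ) ≤ N := by exact_mod_cast hlN
  rcases h1 i j with h | h <;> simp [Pi.smul_apply, h] <;> omega

/-- The dilated tetrahedron is an injective configuration for `l ≥ 1`. -/
theorem smul_tetra_injective {l : ℕ} (hl : 1 ≤ l) : Function.Injective (fun i => (l : ℤ) • tetra i) := by
  intro i j hij
  have hl0 : (l : ℤ) ≠ 0 := by exact_mod_cast (show l ≠ 0 by omega)
  exact tetra_inj (smul_right_injective (Site 3) hl0 hij)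

/-- **`IndependentStrandsJoin → TetraLatticeBound (2c)`**: the route's crux K1, consumed box by box
(`boxIneq_of_loopJoin`) and passed to the critical state (`boxToCritical`). -/
theorem tetraLatticeBound_of_independentStrandsJoin (hK1 : IndependentStrandsJoin) :
    ∃ c : ℝ, 0 < c ∧ TetraLatticeBound c := by
  have hK1' := hK1
  dsimp only [IndependentStrandsJoin] at hK1'
  obtain ⟨c, hc, h⟩ := hK1'
  refine ⟨2 * c, by positivity, fun l hl => ?_⟩
  obtain ⟨N₀, hN₀⟩ := h l hl
  refine boxToCritical (2 * c) (fun i => (l : ℤ) • tetra i) (smul_tetra_injective hl)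
    ⟨max N₀ l, fun N hN => ?_⟩
  have hmem : ∀ i, (l : ℤ) • tetra i ∈ box 3 N := fun i => smul_tetra_mem_box (le_of_max_le_right hN) i
  exact boxIneq_of_loopJoin N _ (smul_tetra_injective hl) hmem
    (hN₀ N (le_of_max_le_left hN) (fun i => ⟨(l : ℤ) • tetra i, hmem i⟩) (fun i => rfl))

end Lattice

section Limit

open Summit.CriticalPhenomena.Ising3DConformalLimit.Theses.FKParityRobustness (IndependentStrandsJoin JoinForcesU4)
open Summit.CriticalPhenomena.Ising3DConformalLimit.Cruxes.ParityRobustMerging.PlaquetteXorSurgery (tetra tetra_inj)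

/-- A two-vector is injective iff its entries differ. [folklore] -/
theorem injective_pair {α : Type*} {u v : α} (h : u ≠ v) : Function.Injective ![u, v] := by
  intro p q hpq
  fin_cases p <;> fin_cases q <;> simp_all

/-- **Limit step (the logic of item 4471, far merging along the dilations of the tetrahedron)**:
a lattice bound `U₄^crit(l·tetra) ≤ −c·G·G` for all `l ≥ 1` forces `U₄ ≢ 0` for every
non-degenerate pointwise scaling limit `S` — evaluate the limit at the continuum tetrahedron along
the meshes `δ_L = 1/(L+1)`, for which `[tetra/δ_L] = (L+1)·tetra` exactly; `ρ(δ)⁴ ≥ 0` being an even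
power, no positivity of `ρ` is needed. -/
theorem hasNontrivialU4_of_tetraLatticeBound {c : ℝ} (hc : 0 < c) (hT : TetraLatticeBound c)
    (ρ : ℝ → ℝ) (S : CorrFamily 3) (hlim : HasPointwiseScalingLimit (criticalCorr 3) ρ S)
    (hnd : IsNondegenerateTwoPoint S) : HasNontrivialU4 S := by
  -- the continuum tetrahedron
  set y : Fin 4 → EuclideanSpace ℝ (Fin 3) := fun i => WithLp.toLp 2 fun k => (tetra i k : ℝ)
    with hy_def
  have hy : Function.Injective y := by
    intro i j hij
    have h' : (fun k => (tetra i k : ℝ)) = fun k => (tetra j k : ℝ) := by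
      have := congrArg WithLp.ofLp hij
      simpa [hy_def] using this
    apply tetra_inj
    funext k
    have hk := congrFun h' k
    exact_mod_cast hk
  -- the meshes
  set δ : ℕ → ℝ := fun L => 1 / ((L : ℝ) + 1) with hδ_def
  have hδpos : ∀ L, 0 < δ L := fun L => by simp only [hδ_def]; positivity
  have hδ : Tendsto δ atTop (𝓝[>] (0 : ℝ)) :=
    tendsto_nhdsWithin_iff.2 ⟨tendsto_one_div_add_atTop_nhds_zero_nat, Eventually.of_forall hδpos⟩
  have hmesh : ∀ (L : ℕ) (i : Fin 4), latticeApprox (δ L) (y i) = ((L : ℤ) + 1) • tetra i := by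
    intro L i
    funext k
    simp only [latticeApprox_apply, hy_def, hδ_def, Pi.smul_apply, smul_eq_mul]
    have h1 : ((tetra i k : ℤ) : ℝ) / (1 / ((L : ℝ) + 1)) = ((((L : ℤ) + 1) * tetra i k : ℤ) : ℝ) := by
      push_cast
      field_simp
    rw [h1, Int.floor_intCast]
  -- pointwise limits along the meshes
  have T4 : Tendsto (fun L : ℕ => ρ (δ L) ^ 4 * criticalCorr 3 4 (fun i => ((L : ℤ) + 1) • tetra i))
      atTop (𝓝 (S 4 y)) := by
    have h := ((hlim 4).tendsto_at hy).comp hδ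
    refine h.congr' (Eventually.of_forall fun L => ?_)
    simp only [Function.comp_apply, rescaledCorrelator_apply, hmesh]
  have T2 : ∀ {i j : Fin 4}, i ≠ j → Tendsto (fun L : ℕ => ρ (δ L) ^ 2 *
      criticalCorr 3 2 ![((L : ℤ) + 1) • tetra i, ((L : ℤ) + 1) • tetra j]) atTop
        (𝓝 (S 2 ![y i, y j])) := by
    intro i j hij
    have hinj : Function.Injective ![y i, y j] := injective_pair (hy.ne hij)
    have h := ((hlim 2).tendsto_at hinj).comp hδ
    refine h.congr' (Eventually.of_forall fun L => ?_)
    simp only [Function.comp_apply, rescaledCorrelator_apply]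
    congr 2
    funext k
    fin_cases k <;> simp [hmesh]
  have h01 : (0 : Fin 4) ≠ 1 := by decide
  have h23 : (2 : Fin 4) ≠ 3 := by decide
  have h02 : (0 : Fin 4) ≠ 2 := by decide
  have h13 : (1 : Fin 4) ≠ 3 := by decide
  have h03 : (0 : Fin 4) ≠ 3 := by decide
  have h12 : (1 : Fin 4) ≠ 2 := by decide
  -- the lattice inequality at l = L + 1, multiplied by the even power ρ(δ_L)⁴ ≥ 0
  have hineq : ∀ L : ℕ,
      ρ (δ L) ^ 4 * criticalCorr 3 4 (fun i => ((L : ℤ) + 1) • tetra i)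
        - (ρ (δ L) ^ 2 * criticalCorr 3 2 ![((L : ℤ) + 1) • tetra 0, ((L : ℤ) + 1) • tetra 1] *
              (ρ (δ L) ^ 2 * criticalCorr 3 2 ![((L : ℤ) + 1) • tetra 2, ((L : ℤ) + 1) • tetra 3])
            + ρ (δ L) ^ 2 * criticalCorr 3 2 ![((L : ℤ) + 1) • tetra 0, ((L : ℤ) + 1) • tetra 2] *
              (ρ (δ L) ^ 2 * criticalCorr 3 2 ![((L : ℤ) + 1) • tetra 1, ((L : ℤ) + 1) • tetra 3])
            + ρ (δ L) ^ 2 * criticalCorr 3 2 ![((L : ℤ) + 1) • tetra 0, ((L : ℤ) + 1) • tetra 3] *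
              (ρ (δ L) ^ 2 * criticalCorr 3 2 ![((L : ℤ) + 1) • tetra 1, ((L : ℤ) + 1) • tetra 2])) ≤
      -(c * (ρ (δ L) ^ 2 * criticalCorr 3 2 ![((L : ℤ) + 1) • tetra 0, ((L : ℤ) + 1) • tetra 1] *
        (ρ (δ L) ^ 2 * criticalCorr 3 2 ![((L : ℤ) + 1) • tetra 2, ((L : ℤ) + 1) • tetra 3]))) := by
    intro L
    have h := hT (L + 1) (by omega)
    push_cast at h
    have hρ4 : 0 ≤ ρ (δ L) ^ 4 := by positivity
    have h' := mul_le_mul_of_nonneg_left h hρ4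
    nlinarith [h']
  -- pass to the limit
  have hL := T4.sub ((((T2 h01).mul (T2 h23)).add ((T2 h02).mul (T2 h13))).add ((T2 h03).mul (T2 h12)))
  have hR := (((T2 h01).mul (T2 h23)).const_mul c).neg
  have hlim4 : limitConnectedFour S y ≤ -(c * (S 2 ![y 0, y 1] * S 2 ![y 2, y 3])) :=
    le_of_tendsto_of_tendsto' hL hR hineq
  have hpos : 0 < S 2 ![y 0, y 1] * S 2 ![y 2, y 3] :=
    mul_pos (hnd _ (injective_pair (hy.ne h01))) (hnd _ (injective_pair (hy.ne h23)))
  exact ⟨y, hy, ne_of_lt (lt_of_le_of_lt hlim4 (by nlinarith))⟩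

/-- **THE CRUX `JoinForcesU4` (stmt-CriticalPhenomena-14627) holds**: `IndependentStrandsJoin`
(the route's rank-2 crux K1) implies that every non-degenerate pointwise scaling limit of the
critical correlators on `ℤ³` has `U₄ ≢ 0`.  Composition of
`tetraLatticeBound_of_independentStrandsJoin` (odd-part pushforward ×2, additive Aizenman identity,
transport, box limit) and `hasNontrivialU4_of_tetraLatticeBound` (far merging along the dilated
tetrahedra). The renormalisation-positivity hypothesis is not used. -/
theorem joinForcesU4 : JoinForcesU4 := by
  intro hK1 ρ S _ hlim hnd
  obtain ⟨c, hc, hT⟩ := tetraLatticeBound_of_independentStrandsJoin hK1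
  exact hasNontrivialU4_of_tetraLatticeBound hc hT ρ S hlim hnd

end Limit

section FarMerging

open Summit.CriticalPhenomena.Ising3DConformalLimit.Theses.FKParityRobustness (FarMergingGivesU4 JoinForcesU4)
open Summit.CriticalPhenomena.Ising3DConformalLimit.Cruxes.ParityRobustMerging.PlaquetteXorSurgery (tetra tetra_inj)

/-- **Far merging along infinitely many dilations of ANY fixed injective lattice shape forces `U₄ ≢ 0`**
— the route's support item `FarMergingGivesU4` (stmt-CriticalPhenomena-4471), proved: extract a strictly
increasing sequence of good scales (`Filter.extraction_of_frequently_atTop`), take meshes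
`δ_n = 1/L_n` (exact lattice approximation of the integer shape), multiply the lattice inequality by the
even power `ρ(δ_n)⁴ ≥ 0` and pass to the pointwise limit. The positivity hypothesis on `ρ` is unused. -/
theorem farMergingGivesU4 : FarMergingGivesU4 := by
  rintro ⟨c, hc, x, hx, h⟩ ρ S _ hlim hnd
  -- a strictly increasing sequence of good scales
  have hfreq : ∃ᶠ (L : ℕ) in atTop,
      criticalCorr 3 4 (fun i => (L : ℤ) • x i)
        - (criticalCorr 3 2 ![(L : ℤ) • x 0, (L : ℤ) • x 1] * criticalCorr 3 2 ![(L : ℤ) • x 2, (L : ℤ) • x 3]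
          + criticalCorr 3 2 ![(L : ℤ) • x 0, (L : ℤ) • x 2] * criticalCorr 3 2 ![(L : ℤ) • x 1, (L : ℤ) • x 3]
          + criticalCorr 3 2 ![(L : ℤ) • x 0, (L : ℤ) • x 3] * criticalCorr 3 2 ![(L : ℤ) • x 1, (L : ℤ) • x 2]) ≤
        -(c * (criticalCorr 3 2 ![(L : ℤ) • x 0, (L : ℤ) • x 1] * criticalCorr 3 2 ![(L : ℤ) • x 2, (L : ℤ) • x 3])) :=
    Filter.frequently_atTop.2 h
  obtain ⟨φ, hφ, hP⟩ := Filter.extraction_of_frequently_atTop hfreq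
  -- scales `φ (n+1) ≥ 1` and meshes `δ n = 1 / φ (n+1)`
  have hLs1 : ∀ n, 1 ≤ φ (n + 1) := fun n => by
    have := hφ.id_le (n + 1)
    simp only [id] at this
    omega
  have hLs : Tendsto (fun n => φ (n + 1)) atTop atTop := hφ.tendsto_atTop.comp (tendsto_add_atTop_nat 1)
  set δ : ℕ → ℝ := fun n => 1 / ((φ (n + 1) : ℕ) : ℝ) with hδ_def
  have hδpos : ∀ n, 0 < δ n := fun n => by
    have : (1 : ℝ) ≤ ((φ (n + 1) : ℕ) : ℝ) := by exact_mod_cast hLs1 n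
    simp only [hδ_def]
    positivity
  have hδ : Tendsto δ atTop (𝓝[>] (0 : ℝ)) := by
    refine tendsto_nhdsWithin_iff.2 ⟨?_, Eventually.of_forall hδpos⟩
    have h1 : Tendsto (fun n : ℕ => 1 / ((n : ℕ) : ℝ)) atTop (𝓝 0) := tendsto_one_div_atTop_nhds_zero_nat
    exact h1.comp hLs
  -- the continuum shape
  set y : Fin 4 → EuclideanSpace ℝ (Fin 3) := fun i => WithLp.toLp 2 fun k => (x i k : ℝ) with hy_def
  have hy : Function.Injective y := by
    intro i j hij
    have h' : (fun k => (x i k : ℝ)) = fun k => (x j k : ℝ) := by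
      have := congrArg WithLp.ofLp hij
      simpa [hy_def] using this
    apply hx
    funext k
    have hk := congrFun h' k
    exact_mod_cast hk
  have hmesh : ∀ (n : ℕ) (i : Fin 4), latticeApprox (δ n) (y i) = ((φ (n + 1) : ℕ) : ℤ) • x i := by
    intro n i
    funext k
    simp only [latticeApprox_apply, hy_def, hδ_def, Pi.smul_apply, smul_eq_mul]
    have hL0 : ((φ (n + 1) : ℕ) : ℝ) ≠ 0 := by
      have : (1 : ℝ) ≤ ((φ (n + 1) : ℕ) : ℝ) := by exact_mod_cast hLs1 n
      positivity
    have h1 : ((x i k : ℤ) : ℝ) / (1 / ((φ (n + 1) : ℕ) : ℝ)) = ((((φ (n + 1) : ℕ) : ℤ) * x i k : ℤ) : ℝ) := by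
      push_cast
      field_simp
    rw [h1, Int.floor_intCast]
  -- pointwise limits along the meshes
  have T4 : Tendsto (fun n : ℕ => ρ (δ n) ^ 4 * criticalCorr 3 4 (fun i => ((φ (n + 1) : ℕ) : ℤ) • x i))
      atTop (𝓝 (S 4 y)) := by
    have h := ((hlim 4).tendsto_at hy).comp hδ
    refine h.congr' (Eventually.of_forall fun n => ?_)
    simp only [Function.comp_apply, rescaledCorrelator_apply, hmesh]
  have T2 : ∀ {i j : Fin 4}, i ≠ j → Tendsto (fun n : ℕ => ρ (δ n) ^ 2 *
      criticalCorr 3 2 ![((φ (n + 1) : ℕ) : ℤ) • x i, ((φ (n + 1) : ℕ) : ℤ) • x j]) atTop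
        (𝓝 (S 2 ![y i, y j])) := by
    intro i j hij
    have hinj : Function.Injective ![y i, y j] := injective_pair (hy.ne hij)
    have h := ((hlim 2).tendsto_at hinj).comp hδ
    refine h.congr' (Eventually.of_forall fun n => ?_)
    simp only [Function.comp_apply, rescaledCorrelator_apply]
    congr 2
    funext k
    fin_cases k <;> simp [hmesh]
  have h01 : (0 : Fin 4) ≠ 1 := by decide
  have h23 : (2 : Fin 4) ≠ 3 := by decide
  have h02 : (0 : Fin 4) ≠ 2 := by decide
  have h13 : (1 : Fin 4) ≠ 3 := by decide
  have h03 : (0 : Fin 4) ≠ 3 := by decide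
  have h12 : (1 : Fin 4) ≠ 2 := by decide
  -- the lattice inequality at the good scales, times `ρ(δ_n)⁴ ≥ 0`
  have hineq : ∀ n : ℕ,
      ρ (δ n) ^ 4 * criticalCorr 3 4 (fun i => ((φ (n + 1) : ℕ) : ℤ) • x i)
        - (ρ (δ n) ^ 2 * criticalCorr 3 2 ![((φ (n + 1) : ℕ) : ℤ) • x 0, ((φ (n + 1) : ℕ) : ℤ) • x 1] *
              (ρ (δ n) ^ 2 * criticalCorr 3 2 ![((φ (n + 1) : ℕ) : ℤ) • x 2, ((φ (n + 1) : ℕ) : ℤ) • x 3])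
            + ρ (δ n) ^ 2 * criticalCorr 3 2 ![((φ (n + 1) : ℕ) : ℤ) • x 0, ((φ (n + 1) : ℕ) : ℤ) • x 2] *
              (ρ (δ n) ^ 2 * criticalCorr 3 2 ![((φ (n + 1) : ℕ) : ℤ) • x 1, ((φ (n + 1) : ℕ) : ℤ) • x 3])
            + ρ (δ n) ^ 2 * criticalCorr 3 2 ![((φ (n + 1) : ℕ) : ℤ) • x 0, ((φ (n + 1) : ℕ) : ℤ) • x 3] *
              (ρ (δ n) ^ 2 * criticalCorr 3 2 ![((φ (n + 1) : ℕ) : ℤ) • x 1, ((φ (n + 1) : ℕ) : ℤ) • x 2])) ≤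
      -(c * (ρ (δ n) ^ 2 * criticalCorr 3 2 ![((φ (n + 1) : ℕ) : ℤ) • x 0, ((φ (n + 1) : ℕ) : ℤ) • x 1] *
        (ρ (δ n) ^ 2 * criticalCorr 3 2 ![((φ (n + 1) : ℕ) : ℤ) • x 2, ((φ (n + 1) : ℕ) : ℤ) • x 3]))) := by
    intro n
    have h := hP (n + 1)
    have hρ4 : 0 ≤ ρ (δ n) ^ 4 := by positivity
    have h' := mul_le_mul_of_nonneg_left h hρ4
    nlinarith [h']
  have hL := T4.sub ((((T2 h01).mul (T2 h23)).add ((T2 h02).mul (T2 h13))).add ((T2 h03).mul (T2 h12)))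
  have hR := (((T2 h01).mul (T2 h23)).const_mul c).neg
  have hlim4 : limitConnectedFour S y ≤ -(c * (S 2 ![y 0, y 1] * S 2 ![y 2, y 3])) :=
    le_of_tendsto_of_tendsto' hL hR hineq
  have hpos : 0 < S 2 ![y 0, y 1] * S 2 ![y 2, y 3] :=
    mul_pos (hnd _ (injective_pair (hy.ne h01))) (hnd _ (injective_pair (hy.ne h23)))
  exact ⟨y, hy, ne_of_lt (lt_of_le_of_lt hlim4 (by nlinarith))⟩

/-- Second proof of the crux through the route's own glue shape: `IndependentStrandsJoin` gives the
hypothesis of `FarMergingGivesU4` with `x = tetra` (all `l ≥ 1`, a fortiori frequently). -/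
theorem joinForcesU4_via_farMerging : JoinForcesU4 := by
  intro hK1 ρ S hρ hlim hnd
  obtain ⟨c, hc, hT⟩ := tetraLatticeBound_of_independentStrandsJoin hK1
  refine farMergingGivesU4 ⟨c, hc, fun i => tetra i, tetra_inj, fun L₀ => ⟨max L₀ 1, le_max_left _ _, ?_⟩⟩
    ρ S hρ hlim hnd
  exact hT (max L₀ 1) (le_max_right _ _)

end FarMerging

section RouteReadBack

open Summit.CriticalPhenomena.Ising3DConformalLimit.Theses.FKParityRobustness
  (IndependentStrandsJoin StrandsJoinBound LatticeBoundFromStrands)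

/-- **The route's support item `StrandsJoinBound` (stmt-CriticalPhenomena-14647) holds** — the primed
copy is its verbatim text. -/
theorem strandsJoinBound_route : StrandsJoinBound := strandsJoinBound'

/-- **The route's glue item `LatticeBoundFromStrands` (stmt-CriticalPhenomena-14648) holds** (its second
hypothesis, the inlined `StrandsJoinBound`, is not even needed: it is a theorem). -/
theorem latticeBoundFromStrands_route : LatticeBoundFromStrands := by
  intro hK1 _
  obtain ⟨c, hc, hT⟩ := tetraLatticeBound_of_independentStrandsJoin hK1
  exact ⟨c, hc, hT⟩

end RouteReadBack

end Summit.CriticalPhenomena.Ising3DConformalLimit.Cruxes.JoinForcesU4.Sketch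

end
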